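import Literature.AlgebraicGeometry.HodgeTheory.RealMultiplicationDivisorClasses
import Literature.AlgebraicGeometry.Motives.HodgeThetaAnnihilatorLieAlgebra
import Literature.AlgebraicGeometry.ComplexMultiplication.CMFieldActionHOne
import Literature.AlgebraicGeometry.HodgeTheory.HodgeFiltrationModelsReductionProofs
import Literature.AlgebraicGeometry.HodgeTheory.HodgeGroupProductCMFactorClasses
import Literature.AlgebraicGeometry.HodgeTheory.HodgeRiemannPolarizabilityProofs
import Literature.AlgebraicGeometry.Motives.HodgeTensorFactsHolds
import HarnessLib

/-!
# Hodge classes on the powers of an abelian variety whose endomorphism algebra is a totally real field of degree `dim` are generated by divisor classes (Ribet 1983, Thm. 0 with Thm. 1; Hazama 1983, Thm. (1.1)) — the Lie step in the word model and the unconditional assembly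

Family `hodge`, layer `Literature/AlgebraicGeometry/HodgeTheory`. Research context: cell `pub-hodge-ring2`
(HONEST FRAMING: research route conditional on HC_CM; not a corollary; Q11.4-sentence-2 already refuted in
dim ≥ 3), Literature lane, real-multiplication programme R2 — step R2b-ii (the "Lie-to-cycles" link,
geometric half) and the ASSEMBLY of R2a (`Motives/HodgeLieRealPlacesSl2`), the bridge
(`RealMultiplicationHodgeLieAlgebra`), R2b-i (`Motives/HodgeThetaSubalgebraRealPlacesSl2`) and R2b-ii
(`AbelianVarietySlotsWordModel`, `Motives/HodgeThetaAnnihilatorLieAlgebra`, `RealMultiplicationDivisorClasses`).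
UNCONDITIONAL: the tree-light Betti hypotheses `hHD`, `hI` and the instance `HodgeTensorFacts` are
discharged in §3 by the tree theorems `exists_isReal_hodgeModel_holds`, `hodgePQ_independent_of_hodgeModel_holds`,
`hodgeTensorFacts_holds`; no step towards a summit statement (a published theorem, Ribet 1983).

PUBLISHED STATEMENT. Ribet 1983, Thm. 0 (p. 523): «Let `A` be an abelian variety such that `End⁰(A)` is a
totally real field `E` with `dim A / [E:ℚ]` odd [here `= 1`]. Then `Hdg(Aⁿ) = Div(Aⁿ)` for all `n ≥ 1`»,
via Thm. 1 `Hg(A) = R_{E/ℚ} SL₂` (Gordon's survey Thms. 6.2–6.3); Hazama 1983, Thm. (1.1)/§3: for `A` of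
type (1) with `s = 1` the Hodge rings of all powers are generated by divisors, PROOF: the Hodge classes are
the invariants of `𝔥 = 𝔰𝔩₂ × ⋯ × 𝔰𝔩₂` acting diagonally on `H¹(Aⁿ, ℂ) = (V₁ ⊕ ⋯ ⊕ V_k)^{⊕n}`, then the first
fundamental theorem of invariant theory for `SL₂`. The tree held this only as the NAMED FACT
`Ribet1983_hodgeClasses_divisorial_powers_totallyRealField_oddRelDim` feeding
`hodgeConjectureFor_powSucc_of_totallyReal_rank_eq_dim` (`RibetTotallyRealHodgeClasses`); THIS FILE proves
the relative-dimension-one case fact-free (§3).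

SETTING. `A` a complex abelian variety with `End⁰(A) = E` a totally real FIELD, `[E:ℚ] = dim A`; `B` an
abelian variety with a slot structure `g : Fin n → (B ⟶ A)` over `A` (`AVSlots`, e.g. `B = A^{N+1}`); `ψ` a
polarization of the weight-one Hodge structure `H = H¹(A(ℂ); ℚ)`; `V_τ ⊆ H ⊗ ℂ` the two-dimensional joint
eigenspaces of `E` (`τ : E → ℂ`; `Lie Hg(A) ⊗ ℂ = ⊕_τ 𝔰𝔩(V_τ)`, `RealMultiplicationHodgeLieAlgebra`);
`b_τ = (b_τ 0, b_τ 1)` bases of the `V_τ` ADAPTED to the Hodge decomposition (`b_τ 0 ∈ H^{1,0}`,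
`b_τ 1 ∈ H^{0,1}`; `HodgeStructure.exists_hodgeAdapted_blockBasis`); the LETTERS of `B` are the classes
`g_j^* b_τ r ∈ H¹(B(ℂ); ℂ)` (`rmLetters`), indexed by `((j, τ), r)` — colour `(j, τ)`, kind `r`.

NEW FORMAL PROOF (Hodge-group-free).
* §1–§2, the INVARIANCE THEOREM `AVSlots.exists_rmInvariant_coeff` (the analogue for `A` of the tree's
  (E7′) `MultiEllSlots.exists_invariant_coeff` for elliptic curves): every rational `(p,p)`-class on `B`
  (`p ≥ 1`) is `∑_w a(w) · (letters)_w` for a coefficient function `a` such that, for every slot-and-place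
  word `U`, every place `τ` and every trace-free `2 × 2` matrix `N`, the operator `N` placed at the
  positions of place `τ` kills the slice `a(U, −)`: by THEOREM L of `Motives/HodgeThetaAnnihilatorLieAlgebra`
  (the rational Lie algebra of the rational coefficient tensor inside `𝔰𝔭_E(H, ψ)` contains `Θ` after
  complexification, hence is `𝔰𝔭_E(H, ψ)_ℂ ∋ 0 ⊕ 𝔰𝔩(V_τ) ⊕ 0`), transported between the rational letters
  and the adapted letters as in the tree's E7′ and refined to slot-and-place colours (§1).
* §3, the ASSEMBLY: choose `ψ` (`smoothProjective_hodgeStructure_isPolarizable_holds`) and adapted `b_τ`;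
  the classes `b_τ 0 ⌣ b_τ 1` are combinations of rational `(1,1)`-classes
  (`theta_mem_span_rational_oneOne`, the `ψ`-Casimir classes of `RealMultiplicationDivisorClasses`), so the
  colourwise first fundamental theorem (`wordEval_rmLetters_mem_divisorClassesSpan_of_colourwise`) puts
  every rational `(p,p)`-class in `Dᵖ(B) ⊗ ℂ`.

MAIN RESULTS (all proved; no named fact, D-0026):
* §1 (generic word model) `blockLift`, `placeRefine`, `wordDerAt_blockLift_wordSlice`,
  `wordDerAt_colourOp_placeRefine_eq_zero`, `wordEval_placeRefine`.
* §2 `toMatrix_assemble_eq_blockLift`, `AVSlots.exists_rmInvariant_coeff`.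
* §3 `AVSlots.rmHodgeClasses_divisorial`, `AVSlots.isDivisorGenerated_of_isTotallyReal` (`B•(B) ⊆ D•(B) ⊗ ℂ`
  for every `B` with slots over such an `A`); `AbelianVariety.isDivisorGenerated_powSucc_of_isTotallyReal`
  (`IsDivisorGenerated (A^{N+1})`); `hodgeConjectureFor_powSucc_of_isTotallyReal_finrank_eq_dim` — the
  statement of the tree's `hodgeConjectureFor_powSucc_of_totallyReal_rank_eq_dim` WITHOUT its fact binder;
  `hodgeConjectureFor_of_isIsogenous_powSucc_of_isTotallyReal`.

## References

* [Ribet1983] K. A. Ribet, *Hodge classes on certain types of abelian varieties*, Amer. J. Math. 105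
  (1983) 523–538, Thm. 0 and Thm. 1. [cite: Ribet1983, Thm. 0–1]
* [Hazama1983] F. Hazama, Tôhoku Math. J. 35 (1983) 303–308 (held `paper:doi-10-2748-tmj-1178229056`),
  Thm. (1.1), §3 pp. 305–306. [cite: Hazama1983, Thm. (1.1) and §3 (pp. 305–306)]
* [Gordon1997] B. B. Gordon, *A survey of the Hodge conjecture for abelian varieties*,
  arXiv:alg-geom/9709030, §3 and Thms. 6.2–6.3. [cite: Gordon1997, Thms. 6.2–6.3]
* [MoonenZarhin1999LowDim] B. Moonen, Yu. Zarhin, Math. Ann. 315 (1999), §3 (3.1)–(3.4).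
  [cite: MoonenZarhin1999LowDim, §3 (3.1)]
* [GoodmanWallachGTM255] R. Goodman, N. R. Wallach, GTM 255 (2009), §4.1.1. [cite: GoodmanWallachGTM255, §4.1.1]
* [FultonYoungTableaux1997] W. Fulton, *Young Tableaux* (1997), §8.1. [cite: FultonYoungTableaux1997, §8.1]
* [vanGeemen1994HodgeAV] B. van Geemen, LNM 1594 (1994), §2.4–2.5, Lemma 3.7.
  [cite: vanGeemen1994HodgeAV, §2.4–2.5 and Lemma 3.7]
-/

noncomputable section

open scoped TensorProduct
open CategoryTheory Module NumberField

namespace Literature.AlgebraicGeometry.HodgeTheory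

open Literature.AlgebraicTopology.SingularHomology
open Literature.AlgebraicGeometry.Motives (IsSmoothProjective AbelianVariety bettiCohomology
  ofRatClassBaseChange ofRatClassBaseChange_tmul HodgeTensorFacts hodgeTensorFacts_holds)
open Literature.Barriers.HodgeConjecture
open Literature.AlgebraicGeometry.Motives.HodgeStructure
open Literature.AlgebraicGeometry.ComplexMultiplication
open Literature.RepresentationTheory.GeneralLinear
open Literature.NumberTheory.DiophantineGeometry

/-! ### §1 Block matrices placed in all slots, read along slot-and-place words -/

section WordModel

variable {K : Type*} {J T : Type*} {N d : ℕ}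

/-- **The block matrix of a family of `2 × 2` blocks** through an identification `φ : Fin N ≃ T × Fin 2`
of the alphabet with (place, kind): entry `(i, m)` is `(Nf τ)_{r r'}` if `φ i = (τ, r)`, `φ m = (τ, r')`
(same place), and `0` otherwise (the matrix of `⊕_τ Nf τ` in a basis collected from bases of the
blocks). [cite: Hazama1983, §3 (p. 306)] -/
def blockLift [Zero K] [DecidableEq T] (φ : Fin N ≃ T × Fin 2) (Nf : T → Matrix (Fin 2) (Fin 2) K) :
    Matrix (Fin N) (Fin N) K :=
  Matrix.of fun i m => if (φ i).1 = (φ m).1 then Nf (φ m).1 (φ i).2 (φ m).2 else 0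

/-- Entries of `blockLift`. [cite: Hazama1983, §3 (p. 306)] -/
theorem blockLift_apply [Zero K] [DecidableEq T] (φ : Fin N ≃ T × Fin 2)
    (Nf : T → Matrix (Fin 2) (Fin 2) K) (i m : Fin N) :
    blockLift φ Nf i m = if (φ i).1 = (φ m).1 then Nf (φ m).1 (φ i).2 (φ m).2 else 0 :=
  rfl

/-- **Refinement of a coefficient function to slot-and-place colours**: letters `J × Fin N` (slot,
letter) become `(J × T) × Fin 2` ((slot, place), kind) through `φ`. [cite: FultonYoungTableaux1997, §8.1] -/
def placeRefine (φ : Fin N ≃ T × Fin 2) (a : (Fin d → J × Fin N) → K) :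
    (Fin d → (J × T) × Fin 2) → K :=
  fun w => a fun t => ((w t).1.1, φ.symm ((w t).1.2, (w t).2))

/-- Unfolding `placeRefine`. [cite: FultonYoungTableaux1997, §8.1] -/
theorem placeRefine_apply (φ : Fin N ≃ T × Fin 2) (a : (Fin d → J × Fin N) → K)
    (w : Fin d → (J × T) × Fin 2) :
    placeRefine φ a w = a fun t => ((w t).1.1, φ.symm ((w t).1.2, (w t).2)) :=
  rfl

/-- **A block matrix placed in all slots acts on a slice along a slot word as its blocks placed at the
positions of their places act on the refined slices** (`D(⊕_τ N_τ)` on `a(u, −)` at the colour word `ε`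
equals `D((N_{τ(ε_t)})_t)` on the refined slice along `(u_t, τ(ε_t))_t` at the kind word `(r(ε_t))_t`).
[cite: GoodmanWallachGTM255, §4.1.1] [cite: FultonYoungTableaux1997, §8.1] -/
theorem wordDerAt_blockLift_wordSlice [Field K] [Fintype T] [DecidableEq T] (φ : Fin N ≃ T × Fin 2)
    (Nf : T → Matrix (Fin 2) (Fin 2) K) (a : (Fin d → J × Fin N) → K) (u : Fin d → J) (ε : Word N d) :
    wordDerAt K (fun _ : Fin d => blockLift φ Nf) (wordSlice a u) ε =
      wordDerAt K (fun t => Nf (φ (ε t)).1) (wordSlice (placeRefine φ a) fun t => (u t, (φ (ε t)).1))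
        fun t => (φ (ε t)).2 := by
  rw [wordDerAt_apply, wordDerAt_apply]
  refine Finset.sum_congr rfl fun t _ => ?_
  rw [← φ.symm.sum_comp, Fintype.sum_prod_type, Finset.sum_eq_single (φ (ε t)).1]
  · refine Finset.sum_congr rfl fun r _ => ?_
    rw [blockLift_apply, Equiv.apply_symm_apply, if_pos rfl]
    congr 1
    rw [wordSlice_apply, wordSlice_apply, placeRefine_apply]
    congr 1
    funext s
    by_cases hs : s = t
    · subst hs
      simp only [Function.update_self]
    · simp only [Function.update_of_ne hs, Prod.mk.eta, Equiv.symm_apply_apply]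
  · intro τ' _ hτ'
    refine Finset.sum_eq_zero fun r _ => ?_
    rw [blockLift_apply, Equiv.apply_symm_apply, if_neg (Ne.symm hτ'), zero_mul]
  · intro h
    exact absurd (Finset.mem_univ _) h

/-- **Corollary: the block of place `τ`, placed in all slots, kills all slices ⟹ the matrix placed at
the positions of place `τ` (`colourOp`) kills all refined slices.** [cite: GoodmanWallachGTM255, §4.1.1] -/
theorem wordDerAt_colourOp_placeRefine_eq_zero [Field K] [Fintype T] [DecidableEq T] (φ : Fin N ≃ T × Fin 2)
    {a : (Fin d → J × Fin N) → K} (τ : T) (Nτ : Matrix (Fin 2) (Fin 2) K)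
    (h : ∀ u : Fin d → J, wordDerAt K (fun _ : Fin d => blockLift φ (Pi.single τ Nτ)) (wordSlice a u) = 0)
    (U : Fin d → J × T) :
    wordDerAt K (colourOp K (fun t => (U t).2) τ Nτ) (wordSlice (placeRefine φ a) U) = 0 := by
  funext η
  set ε : Word N d := fun t => φ.symm ((U t).2, η t) with hε
  have h1 := congrFun (h fun t => (U t).1) ε
  rw [wordDerAt_blockLift_wordSlice] at h1
  have hU : (fun t => ((U t).1, (φ (ε t)).1)) = U := funext fun t => by
    rw [hε, Equiv.apply_symm_apply]
  have hη : (fun t => (φ (ε t)).2) = η := funext fun t => by rw [hε, Equiv.apply_symm_apply]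
  have hfam : (fun t => (Pi.single τ Nτ : T → Matrix (Fin 2) (Fin 2) K) (φ (ε t)).1) =
      colourOp K (fun t => (U t).2) τ Nτ := funext fun t => by
    rw [colourOp_apply, hε, Equiv.apply_symm_apply, Pi.single_apply]
  rw [hU, hη, hfam] at h1
  rw [h1, Pi.zero_apply, Pi.zero_apply]

/-- **The evaluation is unchanged by the refinement of the letters** (a bijection of the letters).
[cite: FultonYoungTableaux1997, §8.1] -/
theorem wordEval_placeRefine [CommRing K] [Fintype J] [Fintype T] {H M : Type*} [AddCommGroup H] [Module K H]
    [AddCommGroup M] [Module K M] (F : H [⋀^Fin d]→ₗ[K] M) (φ : Fin N ≃ T × Fin 2)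
    (x : J × Fin N → H) (a : (Fin d → J × Fin N) → K) :
    wordEval F (fun jr : (J × T) × Fin 2 => x (jr.1.1, φ.symm (jr.1.2, jr.2))) (placeRefine φ a) =
      wordEval F x a := by
  let θ : (J × T) × Fin 2 ≃ J × Fin N :=
    { toFun := fun jr => (jr.1.1, φ.symm (jr.1.2, jr.2))
      invFun := fun jm => ((jm.1, (φ jm.2).1), (φ jm.2).2)
      left_inv := fun jr => by simp
      right_inv := fun jm => by simp }
  rw [wordEval_apply, wordEval_apply]
  exact Fintype.sum_equiv (Equiv.arrowCongr (Equiv.refl (Fin d)) θ) _ _ fun w => rfl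

end WordModel

/-! ### §2 The invariance theorem for abelian varieties with slots over an abelian variety with real multiplication -/

section RM

variable {A B : AbelianVariety ℂ} {n : ℕ} {g : Fin n → (B ⟶ A)}

variable (A) in
/-- The weight-one `ℚ`-Hodge structure `H¹(A(ℂ); ℚ)` of the tree's Betti universe (proof-internal
abbreviation). [folklore] -/
private abbrev H1' (hHD : exists_isReal_hodgeModel) :=
  BettiUniverse.hodge hHD (AbelianVariety.isSmoothProjective_holds (A := A)) 1

variable (hF : IsField A.endAlgebra)

/-- A number field has positive degree over `ℚ` (instance path through `NumberField`). [folklore] -/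
private theorem finrank_pos_of_numberField' (E : Type*) [Field E] [NumberField E] :
    0 < Module.finrank ℚ E :=
  Module.finrank_pos

include hF in
/-- `dim A > 0` when `[End⁰(A) : ℚ] = dim A`. [folklore] -/
private theorem dim_pos_of_finrank_eq' (hdeg : Module.finrank ℚ A.endAlgebra = A.dim) : 0 < A.dim := by
  have h := finrank_pos_of_numberField' (EndField A hF)
  rw [EndField.finrank_eq hF, hdeg] at h
  exact h

/-- The two elements of `Fin 2`. [folklore] -/
private theorem fin2_eq_zero_or_one (r : Fin 2) : r = 0 ∨ r = 1 := by
  fin_cases r <;> simp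

/-- **The matrix of an assembled block operator in a reindexed collected basis is `blockLift`.**
[cite: Hazama1983, §3 (p. 306)] -/
theorem toMatrix_assemble_eq_blockLift {K : Type*} [Field K] {W : Type*} [AddCommGroup W] [Module K W]
    {T : Type*} [Fintype T] [DecidableEq T] {Wτ : T → Submodule K W} (hint : DirectSum.IsInternal Wτ)
    (b : ∀ τ, Module.Basis (Fin 2) K (Wτ τ)) {M : ℕ} (φ : Fin M ≃ T × Fin 2)
    (cbσ : Module.Basis (Fin M) K W) (hcbσ : ∀ m, cbσ m = (b (φ m).1 (φ m).2 : W))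
    (Nf : T → Matrix (Fin 2) (Fin 2) K) :
    LinearMap.toMatrix cbσ cbσ (RealPlaces.assemble hint b Nf) = blockLift φ Nf := by
  ext i m
  rw [LinearMap.toMatrix_apply, hcbσ m, RealPlaces.assemble_apply_basis, map_sum, Finsupp.coe_finsetSum,
    Finset.sum_apply, blockLift_apply]
  have hb : ∀ a, (b (φ m).1 a : W) = cbσ (φ.symm ((φ m).1, a)) := fun a => by
    rw [hcbσ, Equiv.apply_symm_apply]
  simp only [hb, map_smul, Module.Basis.repr_self, Finsupp.smul_apply, Finsupp.single_apply, smul_eq_mul,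
    mul_ite, mul_one, mul_zero]
  by_cases h : (φ i).1 = (φ m).1
  · rw [if_pos h, Finset.sum_eq_single (φ i).2]
    · rw [if_pos]; rw [← h, Prod.mk.eta, Equiv.symm_apply_apply]
    · intro a _ ha
      rw [if_neg]
      intro hia
      apply ha
      have := congrArg φ hia
      rw [Equiv.apply_symm_apply] at this
      simpa [eq_comm] using congrArg Prod.snd this
    · intro hh; exact absurd (Finset.mem_univ _) hh
  · rw [if_neg h]
    refine Finset.sum_eq_zero fun a _ => ?_
    rw [if_neg]
    intro hia
    apply h
    have := congrArg φ hia
    rw [Equiv.apply_symm_apply] at this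
    simpa [eq_comm] using congrArg Prod.fst this

open scoped Classical in
/-- **The INVARIANCE THEOREM (Ribet 1983 Thm. 0 / Hazama 1983 §3, Lie step, for abelian varieties with
slots over `A`).** Let `A` be a complex abelian variety whose endomorphism algebra is a totally real field
`E` of degree `dim A`, `B` an abelian variety with slots `g` over `A`, `ψ` a polarization of
`H¹(A(ℂ); ℚ)`, and `b_τ` bases of the eigenblocks `V_τ` adapted to the Hodge decomposition. Then every
rational class `c` of type `(p,p)` on `B` (`p ≥ 1`) is `∑_w a(w) · (g b)_w` for a coefficient function
`a` on words in the letters `((j, τ), r)` such that for every slot-and-place word `U`, every place `τ`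
and every trace-free `N ∈ M₂(ℂ)`, the operator `N` placed at the positions of place `τ` kills the slice
`a(U, −)` («the i-th component acts on `V_i ⊕ ⋯ ⊕ V_i` diagonally», Hazama p. 306; `Hg = R_{E/ℚ} SL₂`,
Ribet Thm. 1). Proof: (α) an antisymmetric kind-balanced coefficient function `a_x` in the adapted
letters (`AVSlots.exists_antisymm_kindBalanced_wordEval_eq`); its transform `a_e` to the rational
letters `1 ⊗ e_i` is antisymmetric, hence RATIONAL (`IsAntisymm.exists_eq_algebraMap_of_wordEval_eq`);
`Θ = diag(±1)` in the adapted letters kills the balanced `a_x`, so the matrix of `Θ` kills `a_e`;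
THEOREM L (`HodgeStructure.wordDerAt_eq_zero_of_mapsTo_of_skew`, with Riemann's theorem, the
self-adjointness of `E` for `ψ`, the reality of the characters and `dim V_τ = 2` from
`RealMultiplicationHodgeLieAlgebra`) gives that every block-preserving `ψ_ℂ`-skew operator — in
particular `0 ⊕ N ⊕ 0` at place `τ`, `tr N = 0` — kills `a_e`; transport back to `a_x` and refine the
letters to slot-and-place colours (§1). [cite: Ribet1983, Thm. 0–1 (pp. 523–525)]
[cite: Hazama1983, Thm. (1.1) and §3 (pp. 305–306)] [cite: MoonenZarhin1999LowDim, §3 (3.1)–(3.4)] -/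
theorem AVSlots.exists_rmInvariant_coeff [HodgeTensorFacts.{0, 0}] (hg : AVSlots A B g)
    (hHD : exists_isReal_hodgeModel) (hI : hodgePQ_independent_of_hodgeModel)
    [IsTotallyReal (EndField A hF)] (hdeg : Module.finrank ℚ A.endAlgebra = A.dim)
    (ψ : (BettiUniverse.hodge hHD (AbelianVariety.isSmoothProjective_holds (A := A)) 1).Polarization)
    (b : ∀ τ : EndField A hF →+* ℂ, Module.Basis (Fin 2) ℂ
      ((BettiUniverse.hodge hHD (AbelianVariety.isSmoothProjective_holds (A := A)) 1).eigenBlock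
        (hodgeCharacter hF hHD hI τ)))
    (hb0 : ∀ τ, (b τ 0 : ℂ ⊗[ℚ] bettiCohomology A.X 1) ∈
      (BettiUniverse.hodge hHD (AbelianVariety.isSmoothProjective_holds (A := A)) 1).piece 1 0)
    (hb1 : ∀ τ, (b τ 1 : ℂ ⊗[ℚ] bettiCohomology A.X 1) ∈
      (BettiUniverse.hodge hHD (AbelianVariety.isSmoothProjective_holds (A := A)) 1).piece 0 1)
    {p : ℕ} (hp : 0 < p) {c : complexBetti B.X (2 * p)} (hcQ : IsRationalClass c)
    (hc : IsOfHodgeType B.dim B.X (2 * p) p p c) :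
    ∃ a : (Fin (2 * p) → (Fin n × (EndField A hF →+* ℂ)) × Fin 2) → ℂ,
      wordEval (cupPowOneAlt ℂ (Motives.ComplexPoints B.X) (2 * p)) (rmLetters g b) a = c ∧
      ∀ (U : Fin (2 * p) → Fin n × (EndField A hF →+* ℂ)) (τ : EndField A hF →+* ℂ)
        (N : Matrix (Fin 2) (Fin 2) ℂ), N.trace = 0 →
        wordDerAt ℂ (colourOp ℂ (fun t => (U t).2) τ N) (wordSlice a U) = 0 := by
  classical
  -- the setting
  have hX : IsSmoothProjective A.dim A.X := AbelianVariety.isSmoothProjective_holds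
  haveI : Module.Finite ℚ (bettiCohomology A.X 1) := finite_bettiCohomology_one A
  have hint := isInternal_eigenBlock_hodgeCharacter hF hHD hI
  have h2 := finrank_eigenBlock_hodgeCharacter hF hHD hI hdeg
  have hreal := hodgeCharacter_isReal hF hHD hI
  have hA0 : 0 < A.dim := dim_pos_of_finrank_eq' hF hdeg
  have hself := isAdjointPair_self_of_isTotallyReal hF hHD hI hA0 ψ
  have hodd : Odd (((1 : ℕ) : ℤ)) := ⟨0, by norm_num⟩
  set F := cupPowOneAlt ℂ (Motives.ComplexPoints B.X) (2 * p) with hFdef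
  have hFinj : Function.Injective (exteriorPower.alternatingMapLinearEquiv F) :=
    injective_alternatingMapLinearEquiv_cupPowOneAlt B (2 * p)
  -- bases: the block basis `cbσ` and the rational basis `eC`, both indexed by `Fin M`
  set cbx : Module.Basis ((EndField A hF →+* ℂ) × Fin 2) ℂ (ℂ ⊗[ℚ] bettiCohomology A.X 1) :=
    (hint.collectedBasis b).reindex (Equiv.sigmaEquivProd (EndField A hF →+* ℂ) (Fin 2)) with hcbx
  set eQ := Module.finBasis ℚ (bettiCohomology A.X 1) with heQ
  set eC : Module.Basis (Fin (Module.finrank ℚ (bettiCohomology A.X 1))) ℂ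
    (ℂ ⊗[ℚ] bettiCohomology A.X 1) := Algebra.TensorProduct.basis ℂ eQ with heC
  set φ : Fin (Module.finrank ℚ (bettiCohomology A.X 1)) ≃ (EndField A hF →+* ℂ) × Fin 2 :=
    eC.indexEquiv cbx with hφ
  set cbσ : Module.Basis (Fin (Module.finrank ℚ (bettiCohomology A.X 1))) ℂ
    (ℂ ⊗[ℚ] bettiCohomology A.X 1) := cbx.reindex φ.symm with hcbσdef
  have hcbx : ∀ τr : (EndField A hF →+* ℂ) × Fin 2,
      (cbx τr : ℂ ⊗[ℚ] bettiCohomology A.X 1) = b τr.1 τr.2 := by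
    rintro ⟨τ, r⟩
    simp [cbx, DirectSum.IsInternal.collectedBasis_coe, Equiv.sigmaEquivProd]
  have hcbσ : ∀ m, (cbσ m : ℂ ⊗[ℚ] bettiCohomology A.X 1) = b (φ m).1 (φ m).2 := fun m => by
    rw [hcbσdef, Module.Basis.reindex_apply, Equiv.symm_symm, hcbx]
  -- letters
  set ρ := ofRatClassBaseChangeEquiv hX 1 with hρ
  set v : Module.Basis _ ℂ (complexBetti A.X 1) := cbσ.map ρ with hv
  set eL : Module.Basis _ ℂ (complexBetti A.X 1) := eC.map ρ with heL
  have heLQ : ∀ i, IsRationalClass (eL i) := fun i => by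
    rw [heL, Module.Basis.map_apply, heC, Algebra.TensorProduct.basis_apply, hρ,
      ofRatClassBaseChangeEquiv_apply, ofRatClassBaseChange_tmul, one_smul]
    exact isRationalClass_ofRatClass _
  set κ : Fin (Module.finrank ℚ (bettiCohomology A.X 1)) → Fin 2 := fun m => (φ m).2 with hκ
  have hv_apply : ∀ m, v m = ofRatClassBaseChange (Motives.ComplexPoints A.X) 1
      (b (φ m).1 (φ m).2 : ℂ ⊗[ℚ] bettiCohomology A.X 1) := fun m => by
    rw [hv, Module.Basis.map_apply, hcbσ, hρ, ofRatClassBaseChangeEquiv_apply]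
  have hv0 : ∀ m, κ m = 0 → IsOfHodgeType A.dim A.X 1 1 0 (v m) := by
    intro m hm
    rw [hv_apply, ← BettiUniverse.mem_hodge_piece_iff hHD hI hX (k := 1) (p := 1) (q := 0) rfl]
    have h := hb0 (φ m).1
    change (φ m).2 = 0 at hm
    rw [← hm] at h
    exact h
  have hv1 : ∀ m, κ m = 1 → IsOfHodgeType A.dim A.X 1 0 1 (v m) := by
    intro m hm
    rw [hv_apply, ← BettiUniverse.mem_hodge_piece_iff hHD hI hX (k := 1) (p := 0) (q := 1) rfl]
    have h := hb1 (φ m).1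
    change (φ m).2 = 1 at hm
    rw [← hm] at h
    exact h
  -- (α) an antisymmetric kind-balanced coefficient function in the adapted letters
  obtain ⟨ax, hax_bal, hax_anti, hcax⟩ := hg.exists_antisymm_kindBalanced_wordEval_eq v κ hv0 hv1 hp hc
  -- the change of letters to the rational letters
  set G : Matrix _ _ ℂ := eC.toMatrix cbσ with hG
  set G' : Matrix _ _ ℂ := cbσ.toMatrix eC with hG'
  have hG'G : G' * G = 1 := cbσ.toMatrix_mul_toMatrix_flip eC
  have hve : ∀ m, v m = ∑ i, G i m • eL i := fun m => by
    simp only [hv, heL, Module.Basis.map_apply, ← map_smul, ← map_sum]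
    congr 1
    exact (eC.sum_toMatrix_smul_self (v := ⇑cbσ) (j := m)).symm
  have hletters : ∀ j m, avLetters g v (j, m) = ∑ i, G i m • avLetters g eL (j, i) :=
    avLetters_baseChange g G hve
  set aE := colourChangeAt (fun _ : Fin n => G) ax with haE
  have haE_anti : IsAntisymm aE := hax_anti.colourChangeAt _
  have hcaE : wordEval F (avLetters g eL) aE = c := by
    rw [haE, ← wordEval_eq_wordEval_colourChangeAt F (fun _ : Fin n => G) hletters ax, hcax]
  -- rationality of `aE`
  obtain ⟨q, hq⟩ := hg.exists_rat_wordEval_eq eL heLQ hcQ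
  obtain ⟨q', -, haEq⟩ := haE_anti.exists_eq_algebraMap_of_wordEval_eq hFinj (hg.letterBasis eL)
    (q := q) (by rw [AVSlots.coe_letterBasis, hcaE, hFdef, hq])
  have hslice_e : ∀ u, wordSlice aE u = wordRepAt ℂ (fun _ : Fin (2 * p) => G) (wordSlice ax u) :=
    fun u => wordSlice_colourChangeAt (fun _ : Fin n => G) ax u
  -- the Hodge operator `Θ`: `diag(±1)` in the adapted letters
  obtain ⟨Θ, hΘ⟩ := exists_hodgeTheta (H1' A hHD)
  have hΘb : ∀ m, Θ (cbσ m) = (if κ m = 0 then (1 : ℂ) else -1) • cbσ m := by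
    intro m
    rw [hcbσ]
    change Θ _ = (if (φ m).2 = 0 then (1 : ℂ) else -1) • _
    rcases fin2_eq_zero_or_one (φ m).2 with h0 | h1
    · rw [h0, if_pos rfl]
      have hmem : (b (φ m).1 0 : ℂ ⊗[ℚ] bettiCohomology A.X 1) ∈ (H1' A hHD).piece 1 (((1 : ℕ) : ℤ) - 1) := by
        have e : (((1 : ℕ) : ℤ) - 1) = 0 := by norm_num
        rw [e]; exact hb0 _
      rw [hΘ 1 _ hmem]
      norm_num
    · rw [h1, if_neg one_ne_zero]
      have hmem : (b (φ m).1 1 : ℂ ⊗[ℚ] bettiCohomology A.X 1) ∈ (H1' A hHD).piece 0 (((1 : ℕ) : ℤ) - 0) := by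
        have e : (((1 : ℕ) : ℤ) - 0) = 1 := by norm_num
        rw [e]; exact hb1 _
      rw [hΘ 0 _ hmem]
      norm_num
  have hΘcb : LinearMap.toMatrix cbσ cbσ Θ = kindDiag κ := by
    ext i m
    rw [LinearMap.toMatrix_apply, hΘb, map_smul, Module.Basis.repr_self, Finsupp.smul_apply,
      Finsupp.single_apply, kindDiag, Matrix.diagonal_apply, smul_eq_mul, mul_ite, mul_one, mul_zero]
    by_cases him : i = m
    · subst him; rw [if_pos rfl]
    · rw [if_neg (Ne.symm him), if_neg him]
  have hJG : LinearMap.toMatrix eC eC Θ * G = G * kindDiag κ := by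
    rw [← hΘcb, hG, linearMap_toMatrix_mul_basis_toMatrix, basis_toMatrix_mul_linearMap_toMatrix]
  have hΘq : ∀ u : Fin (2 * p) → Fin n, wordDerAt ℂ (fun _ : Fin (2 * p) => LinearMap.toMatrix eC eC Θ)
      (wordSlice (fun w => algebraMap ℚ ℂ (q' w)) u) = 0 := by
    intro u
    rw [← haEq, hslice_e]
    refine wordDerAt_wordRepAt_eq_zero_of_mul_eq ℂ (fun _ : Fin (2 * p) => G) (fun _ => hJG) ?_
    rw [wordDerAt_const]
    exact wordDer_kindDiag_wordSlice_eq_zero κ hax_bal u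
  -- the coefficient function, refined to slot-and-place colours
  refine ⟨placeRefine φ ax, ?_, fun U τ N hN => ?_⟩
  · rw [← hcax]
    have hx : (fun jr : (Fin n × (EndField A hF →+* ℂ)) × Fin 2 =>
        avLetters g v (jr.1.1, φ.symm (jr.1.2, jr.2))) = rmLetters g b := by
      funext jr
      rw [avLetters_apply, hv_apply, Equiv.apply_symm_apply]
      rfl
    rw [← hx]
    exact wordEval_placeRefine F φ (avLetters g v) ax
  · refine wordDerAt_colourOp_placeRefine_eq_zero φ τ N (fun u => ?_) U
    -- THEOREM L for `Y := 0 ⊕ N ⊕ 0` at place `τ`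
    set Y := RealPlaces.assemble hint b (Pi.single τ N) with hY
    have hYT := RealPlaces.assemble_mapsTo hint b (Pi.single τ N)
    have htr : ∀ τ', ((Pi.single τ N : (EndField A hF →+* ℂ) → Matrix (Fin 2) (Fin 2) ℂ) τ').trace = 0 := by
      intro τ'
      rw [Pi.single_apply]
      split_ifs
      · exact hN
      · exact Matrix.trace_zero _ _
    have hYskew := formBaseChange_assemble_add_eq_zero (H1' A hHD) hodd ψ hself
      (hodgeCharacter hF hHD hI) hint b (Pi.single τ N) htr
    have hL := wordDerAt_eq_zero_of_mapsTo_of_skew (H1' A hHD) hodd ψ hself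
      (hodgeCharacter hF hHD hI) hreal hint h2 eQ q' hΘ hΘq hYT
      hYskew u
    rw [← haEq, hslice_e] at hL
    have hYG : ∀ _t : Fin (2 * p), LinearMap.toMatrix eC eC Y * G = G * LinearMap.toMatrix cbσ cbσ Y :=
      fun _ => by rw [hG, linearMap_toMatrix_mul_basis_toMatrix, basis_toMatrix_mul_linearMap_toMatrix]
    have hblk : LinearMap.toMatrix cbσ cbσ Y = blockLift φ (Pi.single τ N) :=
      toMatrix_assemble_eq_blockLift hint b φ cbσ hcbσ (Pi.single τ N)
    have h3 : wordRepAt ℂ (fun _ : Fin (2 * p) => G)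
        (wordDerAt ℂ (fun _ : Fin (2 * p) => blockLift φ (Pi.single τ N)) (wordSlice ax u)) = 0 := by
      rw [← hblk, wordRepAt_wordDerAt_of_mul_eq ℂ (fun _ : Fin (2 * p) => G) hYG, hL]
    exact wordRepAt_injective ℂ (g := fun _ : Fin (2 * p) => G) (g' := fun _ : Fin (2 * p) => G')
      (funext fun _ => hG'G) (by rw [h3, map_zero])

end RM

/-! ### §3 The unconditional assembly: `B•(Aⁿ) = D•(Aⁿ) ⊗ ℂ` and the Hodge conjecture for the powers -/

section Assembly

variable {A B : AbelianVariety ℂ} {n : ℕ} {g : Fin n → (B ⟶ A)}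

/-- **`Bᵖ(B) ⊆ Dᵖ(B) ⊗ ℂ` for an abelian variety `B` with slots over an abelian variety `A` whose
endomorphism algebra is a totally real field of degree `dim A`** (in particular `B = Aⁿ`): every rational
class of type `(p,p)` in `H²ᵖ(B(ℂ); ℂ)` is a `ℂ`-combination of products of `p` rational `(1,1)`-classes.
Ribet 1983 Thm. 0 (`dim A / [E:ℚ] = 1`): «`Hdg(Aⁿ) = Div(Aⁿ)` for all `n ≥ 1`»; Hazama 1983 Thm. (1.1)
(type (1), `s = 1`). Assembled from the invariance theorem `AVSlots.exists_rmInvariant_coeff`, the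
`ψ`-Casimir theorem `theta_mem_span_rational_oneOne` and the colourwise first fundamental theorem
`wordEval_rmLetters_mem_divisorClassesSpan_of_colourwise`; `hHD`, `hI`, `HodgeTensorFacts` discharged.
[cite: Ribet1983, Thm. 0–1 (pp. 523–525)] [cite: Hazama1983, Thm. (1.1) and §3 (pp. 305–306)] -/
theorem AVSlots.rmHodgeClasses_divisorial (hg : AVSlots A B g) (hF : IsField A.endAlgebra)
    [IsTotallyReal (EndField A hF)] (hdeg : Module.finrank ℚ A.endAlgebra = A.dim)
    (p : ℕ) (c : complexBetti B.X (2 * p)) (hcQ : IsRationalClass c)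
    (hc : IsOfHodgeType B.dim B.X (2 * p) p p c) :
    c ∈ divisorClassesSpan B.X B.dim p := by
  classical
  rcases Nat.eq_zero_or_pos p with rfl | hp
  · exact AbelianVariety.mem_divisorClassesSpan_zero B c
  have hHD : exists_isReal_hodgeModel := exists_isReal_hodgeModel_holds
  have hI : hodgePQ_independent_of_hodgeModel := hodgePQ_independent_of_hodgeModel_holds
  haveI : HodgeTensorFacts.{0, 0} := hodgeTensorFacts_holds.{0, 0}
  haveI : Module.Finite ℚ (bettiCohomology A.X 1) := finite_bettiCohomology_one A
  have hX : IsSmoothProjective A.dim A.X := AbelianVariety.isSmoothProjective_holds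
  -- a polarization of `H¹(A(ℂ); ℚ)`
  obtain ⟨ψ⟩ : (BettiUniverse.hodge hHD (AbelianVariety.isSmoothProjective_holds (A := A)) 1).IsPolarizable :=
    smoothProjective_hodgeStructure_isPolarizable_holds hX (BettiUniverse.realHodgeModel hHD hX)
      (BettiUniverse.realHodgeModel_isHodgeSymmetric hHD hX) 1
  -- Hodge-adapted block bases
  obtain ⟨b, hb0', hb1'⟩ := exists_hodgeAdapted_blockBasis
    (BettiUniverse.hodge hHD (AbelianVariety.isSmoothProjective_holds (A := A)) 1) Nat.cast_one
    (BettiUniverse.hodge_isEffective hHD hX 1) (hodgeCharacter hF hHD hI) (hodgeCharacter_isReal hF hHD hI)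
    (finrank_eigenBlock_hodgeCharacter hF hHD hI hdeg)
  have hb0 : ∀ τ, (b τ 0 : ℂ ⊗[ℚ] bettiCohomology A.X 1) ∈
      (BettiUniverse.hodge hHD (AbelianVariety.isSmoothProjective_holds (A := A)) 1).piece 1 0 := by
    intro τ
    have h := hb0' τ
    have e : (((1 : ℕ) : ℤ) - 1) = 0 := by norm_num
    rwa [e] at h
  have hb1 : ∀ τ, (b τ 1 : ℂ ⊗[ℚ] bettiCohomology A.X 1) ∈
      (BettiUniverse.hodge hHD (AbelianVariety.isSmoothProjective_holds (A := A)) 1).piece 0 1 := by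
    intro τ
    have h := hb1' τ
    have e : (((1 : ℕ) : ℤ) - 0) = 1 := by norm_num
    rwa [e] at h
  -- the Lie step: an `𝔰𝔩₂`-per-place-invariant coefficient function
  obtain ⟨a, hca, hkill⟩ := hg.exists_rmInvariant_coeff hF hHD hI hdeg ψ b hb0 hb1 hp hcQ hc
  rw [← hca]
  -- the cycle step: `θ_τ ∈ B¹(A) ⊗ ℂ`, then the colourwise first fundamental theorem
  have hθ := theta_mem_span_rational_oneOne hF hHD hI hdeg ψ b hb0 hb1
  exact wordEval_rmLetters_mem_divisorClassesSpan_of_colourwise g b hθ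
    (fun U τ => hkill U τ _ (by simp)) (fun U τ => hkill U τ _ (by simp))

/-- **`IsDivisorGenerated B`** for every abelian variety `B` with slots over an abelian variety whose
endomorphism algebra is a totally real field of degree `dim` (the tree's spelling of `B•(B) = D•(B) ⊗ ℂ`).
[cite: Ribet1983, Thm. 0–1] [cite: Hazama1983, Thm. (1.1)] -/
theorem AVSlots.isDivisorGenerated_of_isTotallyReal (hg : AVSlots A B g) (hF : IsField A.endAlgebra)
    [IsTotallyReal (EndField A hF)] (hdeg : Module.finrank ℚ A.endAlgebra = A.dim) :
    IsDivisorGenerated B :=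
  fun p c hcQ hc => hg.rmHodgeClasses_divisorial hF hdeg p c hcQ hc

/-- **Ribet 1983, Thm. 0 (relative dimension one), for all powers: `B•(A^{N+1}) = D•(A^{N+1}) ⊗ ℂ`** for a
complex abelian variety `A` whose endomorphism algebra is a totally real field of degree `dim A`.
[cite: Ribet1983, Thm. 0–1 (pp. 523–525)] [cite: Hazama1983, Thm. (1.1)] [cite: Gordon1997, Thm. 6.3] -/
theorem AbelianVariety.isDivisorGenerated_powSucc_of_isTotallyReal (A : AbelianVariety ℂ)
    (hF : IsField A.endAlgebra) [IsTotallyReal (EndField A hF)]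
    (hdeg : Module.finrank ℚ A.endAlgebra = A.dim) (N : ℕ) : IsDivisorGenerated (A.powSucc N) :=
  (AVSlots.powSucc A N).isDivisorGenerated_of_isTotallyReal hF hdeg

/-- `A` itself (`N = 0`-free spelling): `B•(A) = D•(A) ⊗ ℂ`. [cite: Ribet1983, Thm. 0–1] -/
theorem AbelianVariety.isDivisorGenerated_of_isTotallyReal (A : AbelianVariety ℂ)
    (hF : IsField A.endAlgebra) [IsTotallyReal (EndField A hF)]
    (hdeg : Module.finrank ℚ A.endAlgebra = A.dim) : IsDivisorGenerated A :=
  (avSlots_self A).isDivisorGenerated_of_isTotallyReal hF hdeg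

/-- **The Hodge conjecture for all powers `A^{N+1}` of a complex abelian variety whose endomorphism algebra is
a totally real field of degree `dim A` — UNCONDITIONAL** (Ribet 1983 Thm. 0 with Lefschetz `(1,1)`, the
tree's `hodgeConjectureFor_of_isDivisorGenerated`). This is the statement of the tree's
`hodgeConjectureFor_powSucc_of_totallyReal_rank_eq_dim` (`RibetTotallyRealHodgeClasses`) without its fact
binder `Ribet1983_hodgeClasses_divisorial_powers_totallyRealField_oddRelDim` (the case `r = 1` of that
fact). [cite: Ribet1983, Thm. 0–1 (pp. 523–525)] [cite: Gordon1997, Thms. 6.2–6.3] -/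
theorem hodgeConjectureFor_powSucc_of_isTotallyReal_finrank_eq_dim (A : AbelianVariety ℂ)
    (hF : IsField A.endAlgebra) (hT : IsTotallyReal (EndField A hF))
    (he : Module.finrank ℚ A.endAlgebra = A.dim) (N : ℕ) :
    HodgeConjectureFor (A.powSucc N).dim (A.powSucc N).X :=
  haveI := hT
  hodgeConjectureFor_of_isDivisorGenerated _
    (AbelianVariety.isDivisorGenerated_powSucc_of_isTotallyReal A hF he N)

/-- **The Hodge conjecture for every complex abelian variety isogenous to such a power** (van Geemen
Lemma 3.7 = the tree's `HodgeConjectureFor.of_isIsogenous`). [cite: vanGeemen1994HodgeAV, Lemma 3.7]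
[cite: Ribet1983, Thm. 0–1] -/
theorem hodgeConjectureFor_of_isIsogenous_powSucc_of_isTotallyReal {A B' : AbelianVariety ℂ}
    (hF : IsField A.endAlgebra) (hT : IsTotallyReal (EndField A hF))
    (he : Module.finrank ℚ A.endAlgebra = A.dim) {N : ℕ} (hB : B'.IsIsogenous (A.powSucc N)) :
    HodgeConjectureFor B'.dim B'.X :=
  HodgeConjectureFor.of_isIsogenous hB (hodgeConjectureFor_powSucc_of_isTotallyReal_finrank_eq_dim A hF hT he N)

end Assembly

end Literature.AlgebraicGeometry.HodgeTheory

end
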